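import Summits.HubbardSuperconductivity.HubbardSuperconductivity.Theorems.AnisotropyChordTransferFibre3RowCXParseval
import Summits.HubbardSuperconductivity.HubbardSuperconductivity.Theorems.AnisotropyChordTransferFibre3B1Cells
import Summits.HubbardSuperconductivity.HubbardSuperconductivity.Theorems.AnisotropyChordTransferFibre3MuClosed

/-!
# Route `AnisotropyChord` / H0 rotor rung, row C (KT-2b): POINTWISE majorants of the summand of `XSn` (window and tail)

`…RowCXParseval` writes the phase-defect moment as `X = c_s²·XSn/(8π²) − η²ε₁` with
`XSn = θ²·Σ_k |u(k)|²`, `u(k) = (1 − e^{−ikₓ})(g(k) − g(k−x̂)) + (1 − e^{−iθ})g(k−x̂)`.  In the scaled factors of family B1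
(`G = X₀(k) = θ²g(k)`, `G₋ = X_{(−1,0)}(k) = θ²g(k − x̂)`, `…Fibre3B1Objects`) and the scaled trigonometric weights
`aₓ(k) = 2(1 − cos kₓ)/θ²`, `a_y(k) = 2(1 − cos k_y)/θ²`, `e = 2(1 − cos θ)/θ²`, `d = aₓ(k) − aₓ(k − x̂)`, the summand
`s(k) := θ²|u(k)|²` is, for `k ∉ {0, x̂}` (★ `sN_eq`, exact):
  `s(k) = e·G₋²·(1 − d·G) − d²·(a_y(k) − ν)·G²·G₋²`
(the cross term `2(G−G₋)G₋·Re((1−e^{−ikₓ})(1−e^{iθ})) = −[(d² + e d)]·G·G₋²` is NON-POSITIVE, ≈ −40 % of the total).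
THIS FILE sets up the scaled objects (`sN`, `ax`, `ay`, `ee`, the energy relations `G·(aₓ + a_y − ν) = 1`) and proves the
exact form `sN_eq`; the pointwise majorants built on it (tail: `…RowCXSTail`; window: `…RowCXSWindow`) and the summed
L-uniform bracket (`…RowCXSBracket`, tail controlled by the TOTALS `θ⁴S₂`, `θ⁴T10` of p2's brackets minus window lower
sums — no Jordan constant) follow in separate files.
Prover seat `hubbard-h0-rotor-p1` g28 (route lead); helper for piece A = stmt-HubbardSuperconductivity-23918 of rung 19089
(`--supports`, helper class).  WHAT THIS IS NOT: nothing here proves superconductivity in the Hubbard model; pointwise lemmas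
for one input of ONE row of ONE conditional reduction; the rotor TARGET as originally worded stays FALSE (g15 verdict).
Tree imports only; no sorry, no new axioms.
-/

set_option linter.dupNamespace false
set_option autoImplicit false

noncomputable section

open scoped BigOperators
open Complex

namespace Summit.HubbardSuperconductivity.HubbardSuperconductivity.Theorems.AnisotropyChord.Transfer.Fibre3

namespace RowC

open B1

variable (L : ℕ) [NeZero L]

/-! ## The scaled objects -/

/-- the summand `s(k) := θ²·|u(k)|²` of `XSn` at `λ₂ = νθ²`. -/
def sN (ν : ℝ) (k : Tor L) : ℝ :=
  (2 * Real.pi / L) ^ 2 * Complex.normSq (xsTerm L (ν * (2 * Real.pi / L) ^ 2) k)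

/-- `aₓ(k) = 2(1 − cos kₓ)/θ²`. -/
def ax (k : Tor L) : ℝ := 2 * (1 - (phase L k (ex L)).re) / (2 * Real.pi / L) ^ 2

/-- `a_y(k) = 2(1 − cos k_y)/θ²`. -/
def ay (k : Tor L) : ℝ := 2 * (1 - (phase L k (ey L)).re) / (2 * Real.pi / L) ^ 2

/-- `e = 2(1 − cos θ)/θ² = 2ε₁/θ²`. -/
def ee : ℝ := 2 * eps1 L / (2 * Real.pi / L) ^ 2

/-- `XSn(νθ²) = Σ_k s(k)`. [folklore] -/
theorem XSn_eq_sum_sN (ν : ℝ) : XSn L (ν * (2 * Real.pi / L) ^ 2) = ∑ k : Tor L, sN L ν k := by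
  unfold XSn sN
  rw [Finset.mul_sum]

omit [NeZero L] in
/-- `s(k) ≥ 0`. [folklore] -/
theorem sN_nonneg (ν : ℝ) (k : Tor L) : 0 ≤ sN L ν k := by
  unfold sN
  exact mul_nonneg (sq_nonneg _) (Complex.normSq_nonneg _)

/-! ## Algebra of the scaled factors -/

omit [NeZero L] in
/-- `toTor (−1, 0) = −x̂`. [folklore] -/
theorem toTor_neg_one_zero [NeZero L] : toTor L ((-1 : ℤ), (0 : ℤ)) = -(K1 L) := by
  unfold toTor K1
  ext <;> simp

omit [NeZero L] in
/-- `toTor (0, 0) = 0`. [folklore] -/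
theorem toTor_zero_zero [NeZero L] : toTor L ((0 : ℤ), (0 : ℤ)) = 0 := by
  unfold toTor
  ext <;> simp

/-- `G = X₀(k) = θ²·g(k)`. [folklore] -/
theorem Xf_zero_eq (ν : ℝ) (k : Tor L) :
    Xf L ν ((0 : ℤ), (0 : ℤ)) k = (2 * Real.pi / L) ^ 2 * gres L (ν * (2 * Real.pi / L) ^ 2) k := by
  unfold Xf
  rw [toTor_zero_zero, add_zero]

/-- `G₋ = X_{(−1,0)}(k) = θ²·g(k − x̂)`. [folklore] -/
theorem Xf_negx_eq (ν : ℝ) (k : Tor L) :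
    Xf L ν ((-1 : ℤ), (0 : ℤ)) k = (2 * Real.pi / L) ^ 2 * gres L (ν * (2 * Real.pi / L) ^ 2) (k - K1 L) := by
  unfold Xf
  rw [toTor_neg_one_zero, ← sub_eq_add_neg]

/-- the scaled energy relation `G·(aₓ + a_y − ν) = 1` off the origin (`λ₂ < 2ε₁` guaranteed by `ν < 4/π²`). [folklore] -/
theorem Xf_mul_energy (ν : ℝ) (hν : ν < 4 / Real.pi ^ 2) (k : Tor L) (hk : k ≠ 0) :
    Xf L ν ((0 : ℤ), (0 : ℤ)) k * (ax L k + ay L k - ν) = 1 := by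
  have hLpos : (0 : ℝ) < L := by exact_mod_cast Nat.pos_of_ne_zero (NeZero.ne L)
  have hθ : 0 < (2 * Real.pi / L) ^ 2 := by positivity
  have hpos : 0 < 2 * epsT L k - ν * (2 * Real.pi / L) ^ 2 := two_epsT_sub_pos L ν hν k hk
  have hE : ax L k + ay L k - ν = (2 * epsT L k - ν * (2 * Real.pi / L) ^ 2) / (2 * Real.pi / L) ^ 2 := by
    rw [eq_div_iff hθ.ne', epsT_eq_re]
    unfold ax ay
    field_simp
  rw [hE, Xf_zero_eq]
  unfold gres
  rw [if_neg hk]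
  have h2 := hpos.ne'
  have h3 : (L : ℝ) ^ 2 * epsT L k - 2 * Real.pi ^ 2 * ν ≠ 0 := by
    have : (L : ℝ) ^ 2 * epsT L k - 2 * Real.pi ^ 2 * ν
        = (L : ℝ) ^ 2 / 2 * (2 * epsT L k - ν * (2 * Real.pi / L) ^ 2) := by
      field_simp
    rw [this]; exact mul_ne_zero (by positivity) h2
  field_simp

/-- `aₓ(k − x̂)` shares `a_y` with `k`: `G₋·(aₓ(k − x̂) + a_y(k) − ν) = 1` for `k ≠ x̂`. [folklore] -/
theorem Xf_negx_mul_energy (ν : ℝ) (hν : ν < 4 / Real.pi ^ 2) (k : Tor L) (hk : k ≠ K1 L) :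
    Xf L ν ((-1 : ℤ), (0 : ℤ)) k * (ax L (k - K1 L) + ay L k - ν) = 1 := by
  have hk' : k - K1 L ≠ 0 := sub_ne_zero.mpr hk
  have h := Xf_mul_energy L ν hν (k - K1 L) hk'
  have hy : ay L (k - K1 L) = ay L k := by
    unfold ay
    rw [phase_ey, phase_ey]
    simp [K1]
  rw [Xf_zero_eq] at h
  rw [Xf_negx_eq, ← hy]
  exact h

/-! ## The exact form of the summand off `{0, x̂}` -/

/-- `Re((1 − conj φ_k(x̂))·conj(1 − conj φ_{K₁}(x̂))) = 1 − Re φ_{K₁}(x̂) − Re φ_k(x̂) + Re φ_{k−K₁}(x̂)`. [folklore] -/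
theorem re_cross_weight (k : Tor L) :
    ((1 - zPh L k (ex L)) * (starRingEnd ℂ) (1 - zPh L (K1 L) (ex L))).re
      = 1 - (phase L (K1 L) (ex L)).re - (phase L k (ex L)).re + (phase L (k - K1 L) (ex L)).re := by
  unfold zPh
  rw [map_sub, map_one, Complex.conj_conj]
  have h : (starRingEnd ℂ) (phase L k (ex L)) * phase L (K1 L) (ex L) = (starRingEnd ℂ) (phase L (k - K1 L) (ex L)) :=
    (RowD.conj_phase_sub_K1 L k (ex L)).symm
  have e : (1 - (starRingEnd ℂ) (phase L k (ex L))) * (1 - phase L (K1 L) (ex L))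
      = 1 - phase L (K1 L) (ex L) - (starRingEnd ℂ) (phase L k (ex L)) + (starRingEnd ℂ) (phase L (k - K1 L) (ex L)) := by
    rw [← h]; ring
  rw [e]
  simp only [Complex.sub_re, Complex.add_re, Complex.one_re, Complex.conj_re]

/-- `s(k)` expanded: `s = aₓ(k)(G−G₋)² + e·G₋² + (G−G₋)G₋·(e + aₓ(k) − aₓ(k−x̂))`. [folklore] -/
theorem sN_expand (ν : ℝ) (k : Tor L) :
    sN L ν k
      = ax L k * (Xf L ν ((0 : ℤ), (0 : ℤ)) k - Xf L ν ((-1 : ℤ), (0 : ℤ)) k) ^ 2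
        + ee L * Xf L ν ((-1 : ℤ), (0 : ℤ)) k ^ 2
        + (Xf L ν ((0 : ℤ), (0 : ℤ)) k - Xf L ν ((-1 : ℤ), (0 : ℤ)) k) * Xf L ν ((-1 : ℤ), (0 : ℤ)) k
            * (ee L + ax L k - ax L (k - K1 L)) := by
  have hLpos : (0 : ℝ) < L := by exact_mod_cast Nat.pos_of_ne_zero (NeZero.ne L)
  have hπ := Real.pi_pos
  have hθ : 0 < (2 * Real.pi / L) ^ 2 := by positivity
  set θ2 : ℝ := (2 * Real.pi / L) ^ 2 with hθ2
  rw [Xf_zero_eq, Xf_negx_eq, ← hθ2]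
  unfold sN xsTerm
  rw [← hθ2]
  set g : ℝ := gres L (ν * θ2) k with hg
  set gm : ℝ := gres L (ν * θ2) (k - K1 L) with hgm
  set z : ℂ := zPh L k (ex L) with hz
  set w : ℂ := zPh L (K1 L) (ex L) with hw
  -- expand `|α r + β t|²` for real `r, t`
  have hexp : Complex.normSq ((1 - z) * (((g - gm : ℝ)) : ℂ) + (1 - w) * ((gm : ℝ) : ℂ))
      = Complex.normSq (1 - z) * (g - gm) ^ 2 + Complex.normSq (1 - w) * gm ^ 2
        + 2 * ((g - gm) * gm) * ((1 - z) * (starRingEnd ℂ) (1 - w)).re := by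
    rw [Complex.normSq_add, Complex.normSq_mul, Complex.normSq_mul, Complex.normSq_ofReal, Complex.normSq_ofReal,
      map_mul, Complex.conj_ofReal]
    have : ((1 - z) * ((g - gm : ℝ) : ℂ) * ((starRingEnd ℂ) (1 - w) * ((gm : ℝ) : ℂ))).re
        = (g - gm) * gm * ((1 - z) * (starRingEnd ℂ) (1 - w)).re := by
      have e1 : (1 - z) * ((g - gm : ℝ) : ℂ) * ((starRingEnd ℂ) (1 - w) * ((gm : ℝ) : ℂ))
          = (((g - gm) * gm : ℝ) : ℂ) * ((1 - z) * (starRingEnd ℂ) (1 - w)) := by push_cast; ring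
      rw [e1, Complex.re_ofReal_mul]
    rw [this]
    unfold Complex.normSq
    simp only [MonoidWithZeroHom.coe_mk, ZeroHom.coe_mk]
    ring
  rw [hexp, hz, hw, OuterMaj.normSq_one_sub_zPh, OuterMaj.normSq_one_sub_zPh, re_cross_weight, OuterMaj.phase_K1_ex_re]
  unfold ax ee
  rw [← hθ2]
  field_simp
  ring

/-- ★ THE EXACT SUMMAND off `{0, x̂}`: `s(k) = e·G₋²(1 − dG) − d²(a_y − ν)G²G₋²`, `d = aₓ(k) − aₓ(k − x̂)`. [folklore] -/
theorem sN_eq (ν : ℝ) (hν : ν < 4 / Real.pi ^ 2) (k : Tor L) (hk0 : k ≠ 0) (hk1 : k ≠ K1 L) :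
    sN L ν k
      = ee L * Xf L ν ((-1 : ℤ), (0 : ℤ)) k ^ 2 * (1 - (ax L k - ax L (k - K1 L)) * Xf L ν ((0 : ℤ), (0 : ℤ)) k)
        - (ax L k - ax L (k - K1 L)) ^ 2 * (ay L k - ν)
            * Xf L ν ((0 : ℤ), (0 : ℤ)) k ^ 2 * Xf L ν ((-1 : ℤ), (0 : ℤ)) k ^ 2 := by
  have hG := Xf_mul_energy L ν hν k hk0
  have hGm := Xf_negx_mul_energy L ν hν k hk1
  rw [sN_expand]
  set G := Xf L ν ((0 : ℤ), (0 : ℤ)) k with hGdef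
  set Gm := Xf L ν ((-1 : ℤ), (0 : ℤ)) k with hGmdef
  have hdiff : G - Gm = -((ax L k - ax L (k - K1 L)) * G * Gm) := by
    linear_combination Gm * hG - G * hGm
  rw [hdiff]
  linear_combination ((ax L k - ax L (k - K1 L)) ^ 2 * G * Gm ^ 2) * hG

end RowC

end Summit.HubbardSuperconductivity.HubbardSuperconductivity.Theorems.AnisotropyChord.Transfer.Fibre3

end
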